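import Summits.QuantumFields.YangMills.Theorems.SwapVirialDeficitSectorLaplaceEndGaussCoreRate
import HarnessLib

/-!
# THE TIP OF SKELETON ➎: the TWO-RATE normal form — a `τ`-rate plus a `b^{−η}`-rate on a polynomial window give the registered shape with ANY constant `q`
# (cell ym-idea-1; free-hands support of ⟨stmt-QuantumFields-24197⟩ `SwapVirialDeficit.SwapGluedStiffness`; bookkeeping for `hT` of ✓`stub_core_tip_of_tipBound`
# (w2 g60 ✓`…TipCoreReduction`) along w2 g60 memo3 ∕ w3 g68 ⧗`tipMid_le_shell_of_pointwise` ∕ `hubIntegral_hubAt_two_sided`)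

The TIP comparison produces two kinds of smallness: the tip-mid ∕ shell share `∝ poly(L)·√τ∕r(L)²` (a `τ`-RATE, as for the END, ✓`gaussCore_of_rate`) and the
excess `(1+E)` of the two-sided law down the tip together with the tip-core `δ > δ_b(b)` (a `b^{−η}`-RATE, polynomial in `L` and `τ⁻¹`).  This file turns
`lhs ≤ (C·L^c·τ^γ + D·L^d·τ⁻¹^{d′}·b^{−η})·main` on a window `τ ≤ τw∕L^{kw}`, `b ≥ K₁·L^{k₁}·τ⁻¹^{k₁}` into the registered shape
`∃ K k τ₀, ∀ τ ≤ τ₀∕L^k, ∀ b ≥ K·L^k·τ⁻¹^k, lhs ≤ q·main` for ANY `q > 0` (`q = 1∕64` for `hT`, `1∕128` for `hG♭`):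
* `brate_le_half` — the `b`-bookkeeping: `D·L^d·τ⁻¹^{d′}·b^{−η} ≤ q∕2` once `b ≥ (2D∕q+1)^M·L^{M(d+d′)}·τ⁻¹^{M(d+d′)}`, `M = ⌈1∕η⌉₊ + 1`;
* `trate_le_half` — the `τ`-bookkeeping: `C·L^c·τ^γ ≤ q∕2` once `τ ≤ ((q∕2)∕C)^{1∕γ}∕L^{⌈c∕γ⌉₊+1}`;
* ★★ `core_of_two_rates` — the normal form.

HONEST LABEL: pure real bookkeeping; `stub_core_tip`, ⟨24197⟩ ∕ ⟨24194⟩ OPEN; item of record ⟨24085⟩ `SubOctaveBounded` aside ∕ untouched; the Yang–Mills mass gap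
is NOT proved; no summit is proved by a line.  THEOREMS ONLY (0 `def`, 0 `sorry`), standard axioms, no instances.  Seat ym-line-fcl-p3 g49 (cell ym-idea-1, free hands =
➎ assembler), `--supports stmt-QuantumFields-24197`.  References: [folklore].
-/

set_option autoImplicit false

noncomputable section

open Set

namespace Summit.QuantumFields.YangMills.Theorems.SwapVirialDeficit.SectorLaplace

open Summit.QuantumFields.YangMills.Theorems.SwapVirialDeficit.BlowUpRing

/-! ## §1 The two bookkeepings -/

/-- ★ **THE `b`-BOOKKEEPING**: for `q > 0`, `D ≥ 0`, `η > 0`, `M = ⌈1∕η⌉₊ + 1`, `1 ≤ L`, `0 < τ ≤ 1` and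
`b ≥ (2D∕q + 1)^M · L^{M(d+d′)} · τ⁻¹^{M(d+d′)}`: `D·L^d·τ⁻¹^{d′}·b^{−η} ≤ q∕2` (and `1 ≤ b`). [folklore] -/
theorem brate_le_half {q D η L τ b : ℝ} {d d' : ℕ} (hq : 0 < q) (hD : 0 ≤ D) (hη : 0 < η) (hL : 1 ≤ L) (hτ : 0 < τ) (hτ1 : τ ≤ 1)
    (hb : (2 * D / q + 1) ^ (⌈1 / η⌉₊ + 1) * L ^ ((⌈1 / η⌉₊ + 1) * (d + d')) * τ⁻¹ ^ ((⌈1 / η⌉₊ + 1) * (d + d')) ≤ b) :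
    1 ≤ b ∧ D * L ^ d * τ⁻¹ ^ d' * b ^ (-η) ≤ q / 2 := by
  set M : ℕ := ⌈1 / η⌉₊ + 1 with hM
  have hτi1 : 1 ≤ τ⁻¹ := by rw [one_le_inv₀ hτ]; exact hτ1
  have hA1 : 1 ≤ 2 * D / q + 1 := by have : 0 ≤ 2 * D / q := by positivity
                                     linarith
  have hK1 : (1 : ℝ) ≤ (2 * D / q + 1) ^ M := one_le_pow₀ hA1
  set Y : ℝ := (2 * D / q + 1) ^ M * L ^ (M * (d + d')) * τ⁻¹ ^ (M * (d + d')) with hY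
  have hY1 : 1 ≤ Y := by
    rw [hY]
    calc (1 : ℝ) = 1 * 1 * 1 := by ring
      _ ≤ (2 * D / q + 1) ^ M * L ^ (M * (d + d')) * τ⁻¹ ^ (M * (d + d')) :=
          mul_le_mul (mul_le_mul hK1 (one_le_pow₀ hL) zero_le_one (by positivity)) (one_le_pow₀ hτi1) zero_le_one (by positivity)
  have hb1 : 1 ≤ b := hY1.trans hb
  have hb0 : 0 < b := by linarith
  refine ⟨hb1, ?_⟩
  -- `M η ≥ 1`
  have hMη : 1 ≤ (M : ℝ) * η := by
    have h1 : 1 / η ≤ ⌈1 / η⌉₊ := Nat.le_ceil _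
    have h2 : ((⌈1 / η⌉₊ : ℕ) : ℝ) + 1 ≤ (M : ℝ) := by rw [hM]; push_cast; linarith
    rw [div_le_iff₀ hη] at h1
    nlinarith
  -- `b^η ≥ (2D/q+1) · L^d · τ⁻¹^{d'}`
  have hZ : (2 * D / q + 1) * L ^ d * τ⁻¹ ^ d' ≤ b ^ η := by
    have hYη : Y ^ η ≤ b ^ η := Real.rpow_le_rpow (by linarith) hb hη.le
    refine le_trans ?_ hYη
    rw [hY, Real.mul_rpow (by positivity) (by positivity), Real.mul_rpow (by positivity) (by positivity)]
    have e1 : ((2 * D / q + 1) ^ M) ^ η = (2 * D / q + 1) ^ ((M : ℝ) * η) := by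
      rw [← Real.rpow_natCast, ← Real.rpow_mul (by linarith)]
    have e2 : (L ^ (M * (d + d'))) ^ η = L ^ (((M * (d + d') : ℕ) : ℝ) * η) := by
      rw [← Real.rpow_natCast, ← Real.rpow_mul (by linarith)]
    have e3 : (τ⁻¹ ^ (M * (d + d'))) ^ η = τ⁻¹ ^ (((M * (d + d') : ℕ) : ℝ) * η) := by
      rw [← Real.rpow_natCast, ← Real.rpow_mul (by positivity)]
    rw [e1, e2, e3]
    have h1 : (2 * D / q + 1) ≤ (2 * D / q + 1) ^ ((M : ℝ) * η) := by
      calc (2 * D / q + 1) = (2 * D / q + 1) ^ (1 : ℝ) := (Real.rpow_one _).symm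
        _ ≤ (2 * D / q + 1) ^ ((M : ℝ) * η) := Real.rpow_le_rpow_of_exponent_le hA1 hMη
    have hexp : ((d + d' : ℕ) : ℝ) ≤ ((M * (d + d') : ℕ) : ℝ) * η := by
      have h0 : (0 : ℝ) ≤ ((d + d' : ℕ) : ℝ) := by positivity
      push_cast at hMη ⊢
      nlinarith
    have h2 : L ^ d ≤ L ^ (((M * (d + d') : ℕ) : ℝ) * η) := by
      calc L ^ d ≤ L ^ (d + d') := pow_le_pow_right₀ hL (Nat.le_add_right _ _)
        _ = L ^ (((d + d' : ℕ) : ℝ)) := (Real.rpow_natCast _ _).symm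
        _ ≤ L ^ (((M * (d + d') : ℕ) : ℝ) * η) := Real.rpow_le_rpow_of_exponent_le hL hexp
    have h3 : τ⁻¹ ^ d' ≤ τ⁻¹ ^ (((M * (d + d') : ℕ) : ℝ) * η) := by
      calc τ⁻¹ ^ d' ≤ τ⁻¹ ^ (d + d') := pow_le_pow_right₀ hτi1 (Nat.le_add_left _ _)
        _ = τ⁻¹ ^ (((d + d' : ℕ) : ℝ)) := (Real.rpow_natCast _ _).symm
        _ ≤ τ⁻¹ ^ (((M * (d + d') : ℕ) : ℝ) * η) := Real.rpow_le_rpow_of_exponent_le hτi1 hexp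
    exact mul_le_mul (mul_le_mul h1 h2 (by positivity) (by positivity)) h3 (by positivity) (by positivity)
  have hZ0 : 0 < (2 * D / q + 1) * L ^ d * τ⁻¹ ^ d' := by positivity
  have hbη0 : 0 < b ^ η := Real.rpow_pos_of_pos hb0 _
  rw [Real.rpow_neg hb0.le]
  calc D * L ^ d * τ⁻¹ ^ d' * (b ^ η)⁻¹ ≤ D * L ^ d * τ⁻¹ ^ d' * ((2 * D / q + 1) * L ^ d * τ⁻¹ ^ d')⁻¹ :=
        mul_le_mul_of_nonneg_left ((inv_le_inv₀ hbη0 hZ0).2 hZ) (by positivity)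
    _ = D / (2 * D / q + 1) := by field_simp
    _ ≤ q / 2 := by
        rw [div_le_div_iff₀ (by positivity) (by norm_num)]
        have e : q * (2 * D / q + 1) = 2 * D + q := by field_simp
        nlinarith [e]

/-- ★ **THE `τ`-BOOKKEEPING** (✓`gaussCore_of_rate`'s core): for `q, C, γ > 0`, `1 ≤ L`, `0 < τ ≤ ((q∕2)∕C)^{1∕γ}∕L^{⌈c∕γ⌉₊+1}`: `C·L^c·τ^γ ≤ q∕2`. [folklore] -/
theorem trate_le_half {q C γ L τ : ℝ} {c : ℕ} (hq : 0 < q) (hC : 0 < C) (hγ : 0 < γ) (hL : 1 ≤ L) (hτ : 0 < τ)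
    (hτle : τ ≤ ((q / 2) / C) ^ (1 / γ) / L ^ (⌈(c : ℝ) / γ⌉₊ + 1)) :
    C * L ^ c * τ ^ γ ≤ q / 2 := by
  set N : ℕ := ⌈(c : ℝ) / γ⌉₊ + 1 with hN
  set τ₁ : ℝ := ((q / 2) / C) ^ (1 / γ) with hτ₁
  have hL0 : 0 < L := by linarith
  have hτ₁0 : 0 < τ₁ := Real.rpow_pos_of_pos (by positivity) _
  have hτγ : τ ^ γ ≤ (τ₁ / L ^ N) ^ γ := Real.rpow_le_rpow hτ.le hτle hγ.le
  have hsplit : (τ₁ / L ^ N) ^ γ = τ₁ ^ γ / (L ^ N) ^ γ := Real.div_rpow hτ₁0.le (by positivity) γ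
  have hτ₁γ : τ₁ ^ γ = (q / 2) / C := by
    rw [hτ₁, ← Real.rpow_mul (by positivity), one_div_mul_cancel hγ.ne', Real.rpow_one]
  have hcN : (c : ℝ) ≤ (N : ℝ) * γ := by
    have h1 : (c : ℝ) / γ ≤ ⌈(c : ℝ) / γ⌉₊ := Nat.le_ceil _
    have h2 : (⌈(c : ℝ) / γ⌉₊ : ℝ) + 1 ≤ (N : ℝ) := by rw [hN]; push_cast; linarith
    rw [div_le_iff₀ hγ] at h1
    nlinarith
  have hLpow : L ^ c ≤ (L ^ N) ^ γ := by
    rw [← Real.rpow_natCast L c, ← Real.rpow_natCast L N, ← Real.rpow_mul hL0.le]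
    exact Real.rpow_le_rpow_of_exponent_le hL hcN
  have hLγ0 : 0 < (L ^ N) ^ γ := Real.rpow_pos_of_pos (by positivity) _
  calc C * L ^ c * τ ^ γ ≤ C * L ^ c * (τ₁ ^ γ / (L ^ N) ^ γ) := by rw [← hsplit]; exact mul_le_mul_of_nonneg_left hτγ (by positivity)
    _ = C * τ₁ ^ γ * (L ^ c / (L ^ N) ^ γ) := by ring
    _ ≤ C * τ₁ ^ γ * 1 := by
        refine mul_le_mul_of_nonneg_left ((div_le_one hLγ0).2 hLpow) ?_
        rw [hτ₁γ]; positivity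
    _ = q / 2 := by rw [hτ₁γ]; field_simp

/-! ## §2 ★★ The two-rate normal form -/

/-- ★★ **THE TWO-RATE NORMAL FORM**: for ANY left sides `lhs`, main terms `main ≥ 0` and constant `q > 0`: if
`lhs L τ b ε ≤ (C·L^c·τ^γ + D·L^d·τ⁻¹^{d′}·b^{−η})·main L τ b ε` for all `L`, `0 < τ ≤ τw∕L^{kw}`, `b ≥ K₁·L^{k₁}·τ⁻¹^{k₁}`, good `ε`
(`C, γ, η, K₁, τw > 0`, `D ≥ 0`), then `∃ K k τ₀: lhs ≤ q·main` for all `τ ≤ τ₀∕L^k`, `b ≥ K·L^k·τ⁻¹^k` (✓`trate_le_half` + ✓`brate_le_half`). [folklore] -/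
theorem core_of_two_rates (lhs main : ∀ L : ℕ, ℝ → ℝ → GnoSign L → ℝ) (hmain : ∀ (L : ℕ) (τ b : ℝ) (ε : GnoSign L), 0 ≤ main L τ b ε)
    {q C D γ η K₁ τw : ℝ} {c d d' k₁ kw : ℕ} (hq : 0 < q) (hC : 0 < C) (hD : 0 ≤ D) (hγ : 0 < γ) (hη : 0 < η) (hK₁ : 0 < K₁) (hτw : 0 < τw)
    (hrate : ∀ (L : ℕ) [NeZero L] (τ : ℝ), 0 < τ → τ ≤ τw / (L : ℝ) ^ kw → ∀ b : ℝ, K₁ * (L : ℝ) ^ k₁ * τ⁻¹ ^ k₁ ≤ b → ∀ ε : GnoSign L, GoodSign ε →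
      lhs L τ b ε ≤ (C * (L : ℝ) ^ c * τ ^ γ + D * (L : ℝ) ^ d * τ⁻¹ ^ d' * b ^ (-η)) * main L τ b ε) :
    ∃ K : ℝ, 0 < K ∧ ∃ k : ℕ, ∃ τ₀ : ℝ, 0 < τ₀ ∧ τ₀ ≤ 1 / 2 ∧ ∀ (L : ℕ) [NeZero L] (τ : ℝ), 0 < τ → τ ≤ τ₀ / (L : ℝ) ^ k →
      ∀ b : ℝ, K * (L : ℝ) ^ k * τ⁻¹ ^ k ≤ b → ∀ ε : GnoSign L, GoodSign ε → lhs L τ b ε ≤ q * main L τ b ε := by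
  set N : ℕ := ⌈(c : ℝ) / γ⌉₊ + 1 with hN
  set τ₁ : ℝ := ((q / 2) / C) ^ (1 / γ) with hτ₁
  have hτ₁0 : 0 < τ₁ := Real.rpow_pos_of_pos (by positivity) _
  set M : ℕ := ⌈1 / η⌉₊ + 1 with hM
  set K₂ : ℝ := (2 * D / q + 1) ^ M with hK₂
  have hK₂0 : 0 < K₂ := by rw [hK₂]; positivity
  set k₂ : ℕ := M * (d + d') with hk₂
  have hKsum : 0 < K₁ + K₂ := by linarith
  refine ⟨K₁ + K₂, hKsum, k₁ + N + k₂ + kw, min (1 / 2) (min τ₁ τw), lt_min (by norm_num) (lt_min hτ₁0 hτw), min_le_left _ _,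
    fun L _ τ hτ hτle b hb ε hε => ?_⟩
  have hL1 : (1 : ℝ) ≤ L := by exact_mod_cast NeZero.one_le
  set k : ℕ := k₁ + N + k₂ + kw with hk
  have hLk : (1 : ℝ) ≤ (L : ℝ) ^ k := one_le_pow₀ hL1
  have hτ0le : min (1 / 2) (min τ₁ τw) / (L : ℝ) ^ k ≤ min (1 / 2) (min τ₁ τw) := div_le_self (lt_min (by norm_num) (lt_min hτ₁0 hτw)).le hLk
  have hτ1 : τ ≤ 1 := by linarith [hτle.trans (hτ0le.trans (min_le_left _ _))]
  have hτi1 : 1 ≤ τ⁻¹ := by rw [one_le_inv₀ hτ]; exact hτ1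
  -- windows
  have hτw' : τ ≤ τw / (L : ℝ) ^ kw :=
    hτle.trans (div_le_div₀ hτw.le ((min_le_right _ _).trans (min_le_right _ _)) (by positivity) (pow_le_pow_right₀ hL1 (by omega)))
  have hτ₁' : τ ≤ τ₁ / (L : ℝ) ^ N :=
    hτle.trans (div_le_div₀ hτ₁0.le ((min_le_right _ _).trans (min_le_left _ _)) (by positivity) (pow_le_pow_right₀ hL1 (by omega)))
  -- thresholds
  have hmono : ∀ {K' : ℝ} {k' : ℕ}, 0 < K' → K' ≤ K₁ + K₂ → k' ≤ k → K' * (L : ℝ) ^ k' * τ⁻¹ ^ k' ≤ b := by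
    intro K' k' hK' hK'le hk'
    calc K' * (L : ℝ) ^ k' * τ⁻¹ ^ k' ≤ (K₁ + K₂) * (L : ℝ) ^ k * τ⁻¹ ^ k :=
          mul_le_mul (mul_le_mul hK'le (pow_le_pow_right₀ hL1 hk') (by positivity) hKsum.le) (pow_le_pow_right₀ hτi1 hk') (by positivity)
            (mul_nonneg hKsum.le (by positivity))
      _ ≤ b := hb
  have hb₁ : K₁ * (L : ℝ) ^ k₁ * τ⁻¹ ^ k₁ ≤ b := hmono hK₁ (by linarith) (by omega)
  have hb₂ : K₂ * (L : ℝ) ^ k₂ * τ⁻¹ ^ k₂ ≤ b := hmono hK₂0 (by linarith) (by omega)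
  -- the two halves
  have hA : C * (L : ℝ) ^ c * τ ^ γ ≤ q / 2 := trate_le_half hq hC hγ hL1 hτ (by simpa only [hτ₁, hN] using hτ₁')
  obtain ⟨-, hB⟩ := brate_le_half (d := d) (d' := d') hq hD hη hL1 hτ hτ1 (by simpa only [hM, hK₂, hk₂] using hb₂)
  have h := hrate L τ hτ hτw' b hb₁ ε hε
  refine h.trans ?_
  have hm := hmain L τ b ε
  calc (C * (L : ℝ) ^ c * τ ^ γ + D * (L : ℝ) ^ d * τ⁻¹ ^ d' * b ^ (-η)) * main L τ b ε ≤ (q / 2 + q / 2) * main L τ b ε :=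
        mul_le_mul_of_nonneg_right (add_le_add hA hB) hm
    _ = q * main L τ b ε := by ring

end Summit.QuantumFields.YangMills.Theorems.SwapVirialDeficit.SectorLaplace

end
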